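import Summits.AtomisticToContinuum.HydrodynamicLimit.Theorems.BoxDissipativeWeakStrongFluxClosureKineticIsotropyTight
import Summits.AtomisticToContinuum.HydrodynamicLimit.Theorems.CollisionIsometryCLTMesoscopicLLNVelocityGauss
import Literature.MathematicalPhysics.KineticTheory.HardSphereEulerProofs
import HarnessLib

/-!
# Crux `FluxClosure` (stmt-AtomisticToContinuum-9902, route BoxDissipativeWeakStrong), line `registered`:
# Gaussian moments and the traceless algebra of the kinetic-isotropy integrand (rung-0 piece E6, helpers)

Support file (`--supports stmt-AtomisticToContinuum-9902`) of the lead prover's rung-0 (global equilibrium)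
programme for the crux `Summit.AtomisticToContinuum.HydrodynamicLimit.Theses.BoxDissipativeWeakStrong.FluxClosure`.
It collects the position-free ingredients of the Gaussian statics of the kinetic stub K (sub-goal E6,
`FluxClosureEq.E6.kineticIsotropy_static_homogeneous`, file `…FluxClosureEqKinStatic`):

* second moments of coordinate products under the standard Gaussian on `ℝ³` and under the Maxwellian
  `N(u, θ𝟙) = gaussMeasure u θ`: `E[(vᵢ - uᵢ)(vⱼ - uⱼ)] = θ δᵢⱼ` (covariance of `stdGaussian` is the inner
  product, `covarianceBilin_stdGaussian`), `(vᵢ - uᵢ)(vⱼ - uⱼ) ∈ L²` with `Var ≤ θ² E‖w‖⁴` (Fernique);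
* the EXACT TRACELESS IDENTITY `kinStatic_entry_eq`: with the weighted moments `S, M, R, E` of a box
  (`E = tr S/2`) and a constant reference velocity `u`, the K-integrand entry `Sᵢⱼ - MᵢMⱼ/R - δᵢⱼ Rθ̂`
  (`θ̂ = ⅔(E/R - |M|²/(2R²))`) equals `(Z - tr Z/3 𝟙)ᵢⱼ - (D⊗D/R - |D|²/(3R) 𝟙)ᵢⱼ`, `Z` the centred second
  moments around `u` minus `θR𝟙`, `D = M - uR` the momentum fluctuation; whence the pointwise bound
  `kinStatic_abs_entry_le` and its configuration form `kinStatic_abs_kinEntry_le` (registered helper stub):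
  `|Aᵢⱼ| ≤ |Zᵢⱼ| + Σ_k|Z_kk|/3 + (4/3)|D|²/R`, every weight `χ ≥ 0`, empty boxes included.

No definitions. References: H. Spohn, *Large Scale Dynamics of Interacting Particles* (1991), Part I §2.3
(local equilibrium: Maxwellian velocities), §3.3.
-/

noncomputable section

namespace Summit.AtomisticToContinuum.HydrodynamicLimit.Theorems
namespace FluxClosureEq.E6

open scoped BigOperators Topology Classical MeasureTheory ProbabilityTheory InnerProductSpace ENNReal
open Filter Set Function MeasureTheory ProbabilityTheory
open Literature.MathematicalPhysics.KineticTheory Literature.Analysis.FluidPDE Literature.Analysis.FunctionSpaces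
open Summit.AtomisticToContinuum.HydrodynamicLimit.Theses.BoxDissipativeWeakStrong

/-! ### Gaussian second and fourth moments of coordinate products -/

/-- Second moments of the standard Gaussian on `ℝ³`: `E[wᵢ wⱼ] = δᵢⱼ` (covariance `= id`). -/
theorem kinStatic_integral_coord_mul_coord_stdGaussian (i j : Fin 3) :
    ∫ w, w i * w j ∂stdGaussian V3 = if i = j then 1 else 0 := by
  have h := covarianceBilin_apply (μ := stdGaussian V3) IsGaussian.memLp_two_id
    (EuclideanSpace.single i (1 : ℝ)) (EuclideanSpace.single j (1 : ℝ))
  rw [covarianceBilin_stdGaussian] at h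
  simp only [id_eq, integral_id_stdGaussian, sub_zero, EuclideanSpace.inner_single_left, map_one,
    one_mul] at h
  change ⟪EuclideanSpace.single i (1 : ℝ), EuclideanSpace.single j (1 : ℝ)⟫_ℝ = _ at h
  rw [← h, EuclideanSpace.inner_single_left]
  simp

/-- `(wᵢ wⱼ)²` is integrable under the standard Gaussian (dominated by `‖w‖⁴`, Fernique). -/
theorem kinStatic_integrable_coord_mul_coord_sq_stdGaussian (i j : Fin 3) :
    Integrable (fun w : V3 => (w i * w j) ^ 2) (stdGaussian V3) := by
  refine (integrable_norm_pow_four_stdGaussian (ι := Fin 3)).mono' (by fun_prop) (ae_of_all _ fun w => ?_)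
  rw [Real.norm_eq_abs, abs_of_nonneg (sq_nonneg _), mul_pow, show (4 : ℕ) = 2 + 2 from rfl, pow_add]
  have hi : w i ^ 2 ≤ ‖w‖ ^ 2 := by
    rw [← sq_abs]; exact pow_le_pow_left₀ (abs_nonneg _) (by simpa using PiLp.norm_apply_le w i) 2
  have hj : w j ^ 2 ≤ ‖w‖ ^ 2 := by
    rw [← sq_abs]; exact pow_le_pow_left₀ (abs_nonneg _) (by simpa using PiLp.norm_apply_le w j) 2
  exact mul_le_mul hi hj (sq_nonneg _) (sq_nonneg _)

/-- `wᵢ wⱼ ∈ L²` under the standard Gaussian. -/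
theorem kinStatic_memLp_coord_mul_coord_stdGaussian (i j : Fin 3) :
    MemLp (fun w : V3 => w i * w j) 2 (stdGaussian V3) :=
  (memLp_two_iff_integrable_sq (by fun_prop)).2 (kinStatic_integrable_coord_mul_coord_sq_stdGaussian i j)

/-- The peculiar coordinate product along the Gaussian shift: `((u + √θ w)ᵢ - uᵢ)((u + √θ w)ⱼ - uⱼ) = θ wᵢ wⱼ`. -/
theorem kinStatic_peculiarProd_shift (u : V3) {θ : ℝ} (hθ : 0 ≤ θ) (w : V3) (i j : Fin 3) :
    ((u + Real.sqrt θ • w) i - u i) * ((u + Real.sqrt θ • w) j - u j) = θ * (w i * w j) := by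
  simp only [PiLp.add_apply, PiLp.smul_apply, smul_eq_mul, add_sub_cancel_left]
  have h := Real.sq_sqrt hθ
  linear_combination (w i * w j) * h

/-- `(vᵢ - uᵢ)(vⱼ - uⱼ) ∈ L²` under `N(u, θ𝟙)`. -/
theorem kinStatic_memLp_peculiarProd (u : V3) {θ : ℝ} (hθ : 0 ≤ θ) (i j : Fin 3) :
    MemLp (fun v : V3 => (v i - u i) * (v j - u j)) 2 (gaussMeasure u θ) := by
  rw [gaussMeasure]
  refine (memLp_map_measure_iff (by fun_prop) (measurable_gaussShift u θ).aemeasurable).2 ?_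
  have h : (fun v : V3 => (v i - u i) * (v j - u j)) ∘ (fun w : V3 => u + Real.sqrt θ • w) =
      fun w => θ * (w i * w j) := by
    funext w
    exact kinStatic_peculiarProd_shift u hθ w i j
  rw [h]
  exact (kinStatic_memLp_coord_mul_coord_stdGaussian i j).const_mul θ

/-- Covariance of `N(u, θ𝟙)`: `E[(vᵢ - uᵢ)(vⱼ - uⱼ)] = θ δᵢⱼ`. -/
theorem kinStatic_integral_peculiarProd (u : V3) {θ : ℝ} (hθ : 0 < θ) (i j : Fin 3) :
    ∫ v, (v i - u i) * (v j - u j) ∂gaussMeasure u θ = if i = j then θ else 0 := by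
  rw [integral_gaussMeasure u hθ]
  simp_rw [kinStatic_peculiarProd_shift u hθ.le]
  rw [integral_const_mul, kinStatic_integral_coord_mul_coord_stdGaussian]
  split_ifs <;> simp

/-- Variance bound: `Var[(vᵢ - uᵢ)(vⱼ - uⱼ)] ≤ θ² E‖w‖⁴` (`w` standard Gaussian on `ℝ³`). -/
theorem kinStatic_variance_peculiarProd_le (u : V3) {θ : ℝ} (hθ : 0 < θ) (i j : Fin 3) :
    Var[fun v : V3 => (v i - u i) * (v j - u j); gaussMeasure u θ] ≤
      θ ^ 2 * ∫ w, ‖w‖ ^ 4 ∂stdGaussian V3 := by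
  refine (variance_le_expectation_sq (by fun_prop)).trans ?_
  have h2 : ∫ v, ((fun v : V3 => (v i - u i) * (v j - u j)) ^ 2) v ∂gaussMeasure u θ =
      θ ^ 2 * ∫ w, (w i * w j) ^ 2 ∂stdGaussian V3 := by
    simp only [Pi.pow_apply]
    rw [integral_gaussMeasure u hθ]
    simp_rw [kinStatic_peculiarProd_shift u hθ.le, mul_pow]
    rw [integral_const_mul]
  rw [h2]
  refine mul_le_mul_of_nonneg_left (integral_mono (kinStatic_integrable_coord_mul_coord_sq_stdGaussian i j)
    integrable_norm_pow_four_stdGaussian fun w => ?_) (sq_nonneg θ)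
  dsimp only
  rw [mul_pow, show (4 : ℕ) = 2 + 2 from rfl, pow_add]
  have hi : w i ^ 2 ≤ ‖w‖ ^ 2 := by
    rw [← sq_abs]; exact pow_le_pow_left₀ (abs_nonneg _) (by simpa using PiLp.norm_apply_le w i) 2
  have hj : w j ^ 2 ≤ ‖w‖ ^ 2 := by
    rw [← sq_abs]; exact pow_le_pow_left₀ (abs_nonneg _) (by simpa using PiLp.norm_apply_le w j) 2
  exact mul_le_mul hi hj (sq_nonneg _) (sq_nonneg _)

/-! ### The traceless algebra of the K-integrand around a constant reference velocity -/

/-- **Exact identity.** With `S, M, R, E` the weighted second moments, momentum, density and energy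
(`E = tr S / 2`, `nsq = Σ M_k²`), `Zᵢⱼ = Sᵢⱼ - uⱼMᵢ - uᵢMⱼ + uᵢuⱼR - θRδᵢⱼ` the centred peculiar second
moments around `u` and `Dᵢ = Mᵢ - uᵢR` the momentum fluctuation, for `R ≠ 0`:
`Sᵢⱼ - MᵢMⱼ/R - δᵢⱼ Rθ̂ = (Z - tr Z/3)ᵢⱼ - (D⊗D/R - |D|²/(3R))ᵢⱼ`. -/
theorem kinStatic_entry_eq {R θ E nsq : ℝ} {S Z : Fin 3 → Fin 3 → ℝ} {M D u : Fin 3 → ℝ} (hR : R ≠ 0)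
    (hZ : ∀ i j, Z i j = S i j - u j * M i - u i * M j + u i * u j * R - (if i = j then θ * R else 0))
    (hD : ∀ i, D i = M i - u i * R) (hE : E = (∑ k, S k k) / 2) (hn : nsq = ∑ k, M k ^ 2) (i j : Fin 3) :
    S i j - M i * M j / R - (if i = j then R * (2 / 3 * (E / R - nsq / (2 * R ^ 2))) else 0) =
      (Z i j - (if i = j then 1 else 0) * ((∑ k, Z k k) / 3)) -
        (D i * D j / R - (if i = j then 1 else 0) * ((∑ k, D k ^ 2) / R / 3)) := by
  rcases eq_or_ne i j with rfl | hij
  · simp only [if_true, hZ, hD, hE, hn, Fin.sum_univ_three, Fin.isValue, one_mul]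
    field_simp
    ring
  · simp only [if_neg hij, hZ, hD, zero_mul, sub_zero]
    field_simp
    ring

/-- **Pointwise bound.** Under the relations of `kinStatic_entry_eq` (and `S = 0`, `M = 0` in the degenerate
case `R = 0`, `R ≥ 0`): `|Sᵢⱼ - MᵢMⱼ/R - δᵢⱼRθ̂| ≤ |Zᵢⱼ| + Σ_k|Z_kk|/3 + (4/3) Σ_k D_k²/R`. -/
theorem kinStatic_abs_entry_le {R θ E nsq : ℝ} {S Z : Fin 3 → Fin 3 → ℝ} {M D u : Fin 3 → ℝ} (hR0 : 0 ≤ R)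
    (hdeg : R = 0 → (∀ i j, S i j = 0) ∧ ∀ i, M i = 0)
    (hZ : ∀ i j, Z i j = S i j - u j * M i - u i * M j + u i * u j * R - (if i = j then θ * R else 0))
    (hD : ∀ i, D i = M i - u i * R) (hE : E = (∑ k, S k k) / 2) (hn : nsq = ∑ k, M k ^ 2) (i j : Fin 3) :
    |S i j - M i * M j / R - (if i = j then R * (2 / 3 * (E / R - nsq / (2 * R ^ 2))) else 0)| ≤
      |Z i j| + (∑ k, |Z k k|) / 3 + 4 / 3 * ((∑ k, D k ^ 2) / R) := by
  have hZabs : 0 ≤ |Z i j| + (∑ k, |Z k k|) / 3 := by positivity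
  rcases eq_or_lt_of_le hR0 with hR | hR
  · obtain ⟨hS, hM⟩ := hdeg hR.symm
    simp only [hS, hM, ← hR, mul_zero, sub_zero, zero_mul, ite_self, abs_zero, div_zero, add_zero]
    exact hZabs
  · rw [kinStatic_entry_eq hR.ne' hZ hD hE hn i j]
    have hDD : |D i * D j| ≤ ∑ k, D k ^ 2 := by
      have hi : D i ^ 2 ≤ ∑ k, D k ^ 2 :=
        Finset.single_le_sum (f := fun k => D k ^ 2) (fun k _ => sq_nonneg (D k)) (Finset.mem_univ i)
      have hj : D j ^ 2 ≤ ∑ k, D k ^ 2 :=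
        Finset.single_le_sum (f := fun k => D k ^ 2) (fun k _ => sq_nonneg (D k)) (Finset.mem_univ j)
      rw [abs_mul]
      nlinarith [sq_nonneg (|D i| - |D j|), sq_abs (D i), sq_abs (D j), abs_nonneg (D i), abs_nonneg (D j)]
    have hsum0 : 0 ≤ ∑ k, D k ^ 2 := Finset.sum_nonneg fun k _ => sq_nonneg _
    have htr : |∑ k, Z k k| ≤ ∑ k, |Z k k| := Finset.abs_sum_le_sum_abs _ _
    have h1 : |Z i j - (if i = j then 1 else 0) * ((∑ k, Z k k) / 3)| ≤ |Z i j| + (∑ k, |Z k k|) / 3 := by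
      refine (abs_sub _ _).trans (add_le_add le_rfl ?_)
      split_ifs
      · rw [one_mul, abs_div, abs_of_pos (by norm_num : (0 : ℝ) < 3)]
        exact div_le_div_of_nonneg_right htr (by norm_num)
      · rw [zero_mul, abs_zero]; positivity
    have h2 : |D i * D j / R - (if i = j then 1 else 0) * ((∑ k, D k ^ 2) / R / 3)| ≤
        4 / 3 * ((∑ k, D k ^ 2) / R) := by
      refine (abs_sub _ _).trans ?_
      rw [abs_div, abs_of_pos hR]
      have hA : |D i * D j| / R ≤ (∑ k, D k ^ 2) / R := div_le_div_of_nonneg_right hDD hR.le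
      have hB : |(if i = j then 1 else 0 : ℝ) * ((∑ k, D k ^ 2) / R / 3)| ≤ (∑ k, D k ^ 2) / R / 3 := by
        split_ifs
        · rw [one_mul, abs_of_nonneg (by positivity)]
        · rw [zero_mul, abs_zero]; positivity
      have hC : 0 ≤ (∑ k, D k ^ 2) / R := by positivity
      linarith
    exact (abs_sub _ _).trans (by linarith)


/-! ### The K-integrand of a configuration: pointwise bound by centred Gaussian-friendly variables -/

/-- **Pointwise bound for the K-integrand of a configuration** `z` with weight `χ ≥ 0`, around a constant
reference velocity `u` and temperature `θ`: the `(i, j)` entry of `Ŝ - m̂⊗m̂/ρ̂ - ρ̂θ̂𝟙` is bounded by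
`|Zᵢⱼ| + Σ_k |Z_kk|/3 + (4/3) Σ_k D_k²/ρ̂` with `Zᵢⱼ = n⁻¹Σ_a χ(q_a)((v_aⁱ - uⁱ)(v_aʲ - uʲ)) - θρ̂δᵢⱼ` and
`D_k = n⁻¹Σ_a χ(q_a) v_aᵏ - n⁻¹Σ_a χ(q_a) uᵏ` (exact traceless identity `kinStatic_entry_eq`; all terms vanish on
an empty box). -/
theorem kinStatic_abs_kinEntry_le : ∀ (n : ℕ) (z : Config n (Fin 3) T3) (χ : T3 → ℝ), (∀ y, 0 ≤ χ y) → ∀ (u : V3) (θ : ℝ) (i j : Fin 3), |(∫ y, χ y.1 * (y.2 i * y.2 j) ∂(empiricalMeasure z)) - empiricalMomentumField z χ i * empiricalMomentumField z χ j / empiricalDensityField z χ - (if i = j then empiricalDensityField z χ * (2 / 3 * (empiricalEnergyField z χ / empiricalDensityField z χ - ‖empiricalMomentumField z χ‖ ^ 2 / (2 * empiricalDensityField z χ ^ 2))) else 0)| ≤ |(∑ a, (n : ℝ)⁻¹ * χ (z a).1 * (((z a).2 i - u i) * ((z a).2 j - u j))) - (if i = j then θ * empiricalDensityField z χ else 0)|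 + (∑ k, |(∑ a, (n : ℝ)⁻¹ * χ (z a).1 * (((z a).2 k - u k) * ((z a).2 k - u k))) - (if k = k then θ * empiricalDensityField z χ else 0)|) / 3 + 4 / 3 * ((∑ k, ((n : ℝ)⁻¹ * ∑ a, χ (z a).1 * (z a).2 k - (n : ℝ)⁻¹ * ∑ a, χ (z a).1 * u k) ^ 2) / empiricalDensityField z χ) := by
  intro n z χ hχ u θ i j
  have hR : empiricalDensityField z χ = (n : ℝ)⁻¹ * ∑ a, χ (z a).1 := empiricalDensityField_eq_sum z χ
  have hR0 : 0 ≤ empiricalDensityField z χ := by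
    rw [hR]; exact mul_nonneg (inv_nonneg.2 (Nat.cast_nonneg n)) (Finset.sum_nonneg fun a _ => hχ _)
  refine kinStatic_abs_entry_le (S := fun i j => ∫ y, χ y.1 * (y.2 i * y.2 j) ∂(empiricalMeasure z))
    (M := fun k => empiricalMomentumField z χ k) (u := fun k => u k) (θ := θ)
    (E := empiricalEnergyField z χ) (nsq := ‖empiricalMomentumField z χ‖ ^ 2)
    (Z := fun i j => (∑ a, (n : ℝ)⁻¹ * χ (z a).1 * (((z a).2 i - u i) * ((z a).2 j - u j))) -
      (if i = j then θ * empiricalDensityField z χ else 0))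
    (D := fun k => (n : ℝ)⁻¹ * ∑ a, χ (z a).1 * (z a).2 k - (n : ℝ)⁻¹ * ∑ a, χ (z a).1 * u k)
    hR0 ?_ ?_ ?_ ?_ ?_ i j
  · intro h0
    rw [hR] at h0
    have hck : ∀ a, (n : ℝ)⁻¹ * χ (z a).1 = 0 := by
      intro a
      rcases mul_eq_zero.1 h0 with h | h
      · rw [h, zero_mul]
      · rw [(Finset.sum_eq_zero_iff_of_nonneg fun b _ => hχ (z b).1).1 h a (Finset.mem_univ a), mul_zero]
    have hvan : ∀ f : Fin n → ℝ, (n : ℝ)⁻¹ * ∑ a, χ (z a).1 * f a = 0 := fun f => by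
      rw [Finset.mul_sum]
      exact Finset.sum_eq_zero fun a _ => by rw [← mul_assoc, hck a, zero_mul]
    refine ⟨fun i j => ?_, fun k => ?_⟩
    · show (∫ y, χ y.1 * (y.2 i * y.2 j) ∂(empiricalMeasure z)) = 0
      rw [FluxClosureK.integral_weight_mul_vel_mul_vel]
      exact hvan _
    · show empiricalMomentumField z χ k = 0
      rw [DeviatoricStressClosure.empiricalMomentumField_apply]
      exact hvan _
  · intro i j
    show (∑ a, (n : ℝ)⁻¹ * χ (z a).1 * (((z a).2 i - u i) * ((z a).2 j - u j))) -
        (if i = j then θ * empiricalDensityField z χ else 0) =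
      (∫ y, χ y.1 * (y.2 i * y.2 j) ∂(empiricalMeasure z)) - u j * empiricalMomentumField z χ i -
        u i * empiricalMomentumField z χ j + u i * u j * empiricalDensityField z χ -
        (if i = j then θ * empiricalDensityField z χ else 0)
    rw [← MesoLLN.inv_mul_sum_mul, DeviatoricStressClosure.avg_mul_sub_mul_sub_eq,
      FluxClosureK.integral_weight_mul_vel_mul_vel, DeviatoricStressClosure.empiricalMomentumField_apply,
      DeviatoricStressClosure.empiricalMomentumField_apply, hR]
  · intro k
    show (n : ℝ)⁻¹ * ∑ a, χ (z a).1 * (z a).2 k - (n : ℝ)⁻¹ * ∑ a, χ (z a).1 * u k =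
      empiricalMomentumField z χ k - u k * empiricalDensityField z χ
    rw [DeviatoricStressClosure.empiricalMomentumField_apply, hR, ← Finset.sum_mul]
    ring
  · show empiricalEnergyField z χ = (∑ k, ∫ y, χ y.1 * (y.2 k * y.2 k) ∂(empiricalMeasure z)) / 2
    simp_rw [FluxClosureK.integral_weight_mul_vel_mul_vel]
    rw [DeviatoricStressClosure.sum_avg_mul_self_eq, empiricalEnergyField_eq_sum]
    ring
  · exact EuclideanSpace.real_norm_sq_eq _

end FluxClosureEq.E6
end Summit.AtomisticToContinuum.HydrodynamicLimit.Theorems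

end
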